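import Mathlib.NumberTheory.NumberField.CMField
import Mathlib.NumberTheory.RamificationInertia.Galois
import Literature.NumberTheory.ComplexMultiplication.CMLatticeIdealNorm
import Literature.NumberTheory.NumberFields.QuadraticRamifiedLocalModel
import Literature.NumberTheory.NumberFields.RayClassFieldSplitPrimePowerDegreeQuadratic
import HarnessLib

/-!
# The conjugate twister at a split prime of an imaginary quadratic field: `σ` swaps `𝔭, 𝔭̄`;
# `N(σα) = N(α) > 0`; and `(σα)^k ≠ α^k` for the asymmetric congruences of de Shalit II.4.12

De Shalit II.4.12 (p. 66–68) divides by `δ_𝔞 = σ_𝔞 − N𝔞` for TWO twisting ideals with the same norm and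
"independent" Artin symbols — `𝔞` and its complex conjugate `𝔞̄` (same norm, `σ_𝔞̄ σ_𝔞⁻¹` of infinite order
in the `𝔭`-adic tower). In the tree's division step (`GroupDistribution.exists_twisting_μ_eq_of_cocycle_natCast`,
p704309; hypotheses `hN12 : N a₂ = N a₁`, `hτ`) and its Galois-side discharge `hτ_artin`
(`RayClassFieldAdicCharacterDivision.lean`: needs `∀ k > 0, β^k ≠ α^k` in `K_𝔭`), the second twister for a
principal `𝔞 = (α)` is `β = σ(α)`, `σ` the non-trivial automorphism. THIS FILE (for `K` quadratic over `ℚ`,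
two distinct primes `v ≠ v̄` above a rational prime `p` — the split case):

* ★ `exists_algEquiv_smul_eq` (with `liesOver_span_natCast_of_mem` of `QuadraticRamifiedLocalModel.lean`) — **some
  `σ ∈ Aut(K/ℚ)` maps `𝔭_v` to `𝔭_v̄`**, `σ ≠ 1`, `σ² = 1`, and `σ • 𝔭_v̄ = 𝔭_v` (`Gal(K/ℚ)` acts transitively
  on the primes above `p`; it has order `2`);
* `sub_one_mem_smul_pow_iff` — `σα − 1 ∈ (σ•𝔟)` iff `α − 1 ∈ 𝔟` (transport of congruences);
* `norm_smul_eq` — `N(σα) = N(α)`; `norm_pos_of_ne_zero` — `N(α) > 0` (`K` imaginary quadratic);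
  `absNorm_span_singleton_eq_norm` — `N((α)) = N(α)` as integers;
* ★ `pow_smul_ne_pow` — if `(𝓞 K)ˣ = {±1}`, `2 ∈ 𝔭_v ∖ 𝔭_v²` and `α − 1 ∈ 𝔭_v² ∩ 𝔭_v̄^{n+1} ∖ 𝔭_v^{n+1}`, then
  **`(σα)^k ≠ α^k` for every `k > 0`** (else `σα = ±α`: `+` contradicts the asymmetry, `−` gives `2 ∈ 𝔭_v²`).

Theorems only; no `sorry`.

## References
* [deShalit1987] E. de Shalit, *Iwasawa theory of elliptic curves with complex multiplication* (1987),
  II.4.12 (p. 66–68), II.4.17 (p. 77–78).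
* [NeukirchANT1999] J. Neukirch, *Algebraic Number Theory* (1999), Ch. I §9 (9.1) (transitivity), §2 (2.6).
* [Cox2013] D. Cox, *Primes of the form x² + ny²* (2013), §7.A (7.6) (`N(α) = αᾱ > 0`).
-/

noncomputable section

open NumberField IsDedekindDomain
open scoped Pointwise

namespace Literature.NumberTheory.NumberFields

variable {K : Type} [Field K] [NumberField K]

/-! ### §1. The automorphism swapping the two primes above a split `p` -/

/-- ★ **Some `σ ∈ Aut(K/ℚ)` maps `𝔭_v` onto `𝔭_v̄`** (two primes above the same rational prime `p`; `K/ℚ`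
Galois): transitivity of the Galois action on the primes above `p`. [cite: NeukirchANT1999, Ch. I §9 (9.1)] -/
theorem exists_algEquiv_smul_eq [IsGalois ℚ K] {p : ℕ} (hp : p.Prime) {v vbar : HeightOneSpectrum (𝓞 K)}
    (hv : ((p : ℕ) : 𝓞 K) ∈ v.asIdeal) (hvbar : ((p : ℕ) : 𝓞 K) ∈ vbar.asIdeal) :
    ∃ σ : K ≃ₐ[ℚ] K, σ • v.asIdeal = vbar.asIdeal := by
  haveI := liesOver_span_natCast_of_mem v hp hv
  haveI := liesOver_span_natCast_of_mem vbar hp hvbar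
  haveI : (Ideal.span {(p : ℤ)}).IsMaximal :=
    PrincipalIdealRing.isMaximal_of_irreducible (Int.prime_iff_natAbs_prime.mpr (by simpa using hp)).irreducible
  exact Ideal.exists_smul_eq_of_isGaloisGroup (Ideal.span {(p : ℤ)}) v.asIdeal vbar.asIdeal (K ≃ₐ[ℚ] K)

/-- In a quadratic field an automorphism moving a prime is the non-trivial one, of order `2`, and moves the
second prime back: `σ ≠ 1`, `σ * σ = 1`, `σ • 𝔭_v̄ = 𝔭_v`. [cite: NeukirchANT1999, Ch. I §9 (9.1)] -/
theorem algEquiv_swap_spec (hK2 : Module.finrank ℚ K = 2) {v vbar : HeightOneSpectrum (𝓞 K)}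
    (hne : vbar ≠ v) {σ : K ≃ₐ[ℚ] K} (hσ : σ • v.asIdeal = vbar.asIdeal) :
    σ ≠ 1 ∧ σ * σ = 1 ∧ σ • vbar.asIdeal = v.asIdeal := by
  haveI : Algebra.IsQuadraticExtension ℚ K := ⟨hK2⟩
  have hσ1 : σ ≠ 1 := by
    rintro rfl
    rw [one_smul] at hσ
    exact hne (HeightOneSpectrum.ext hσ.symm)
  have hcard : Nat.card (K ≃ₐ[ℚ] K) = 2 := by rw [IsGalois.card_aut_eq_finrank, hK2]
  obtain ⟨τ, hτ1, hτ⟩ := (Nat.card_eq_two_iff' (1 : K ≃ₐ[ℚ] K)).mp hcard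
  have hστ : σ = τ := hτ σ hσ1
  have hσσ : σ * σ = 1 := by
    by_contra h
    exact hσ1 (by simpa [mul_eq_left] using (hτ (σ * σ) h).trans hστ.symm)
  refine ⟨hσ1, hσσ, ?_⟩
  rw [← hσ, smul_smul, hσσ, one_smul]

/-! ### §2. Transport of congruences, norms -/

/-- **Transport of congruences**: `σα − 1 ∈ σ•𝔟 ⟺ α − 1 ∈ 𝔟`. [cite: NeukirchANT1999, Ch. I §9 (9.1)] -/
theorem sub_one_mem_smul_iff (σ : K ≃ₐ[ℚ] K) (𝔟 : Ideal (𝓞 K)) (α : 𝓞 K) :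
    σ • α - 1 ∈ σ • 𝔟 ↔ α - 1 ∈ 𝔟 := by
  rw [show σ • α - 1 = σ • (α - 1) by rw [smul_sub, smul_one], Ideal.smul_mem_pointwise_smul_iff]

/-- The same for a power `𝔟 = 𝔮ᵏ`: `σα − 1 ∈ (σ•𝔮)ᵏ ⟺ α − 1 ∈ 𝔮ᵏ`. [cite: NeukirchANT1999, Ch. I §9 (9.1)] -/
theorem sub_one_mem_smul_pow_iff (σ : K ≃ₐ[ℚ] K) (𝔮 : Ideal (𝓞 K)) (k : ℕ) (α : 𝓞 K) :
    σ • α - 1 ∈ (σ • 𝔮) ^ k ↔ α - 1 ∈ 𝔮 ^ k := by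
  rw [← smul_pow', sub_one_mem_smul_iff]

/-- **`N(σα) = N(α)`**. [cite: NeukirchANT1999, Ch. I §2 (2.6)] -/
theorem norm_smul_eq (σ : K ≃ₐ[ℚ] K) (α : 𝓞 K) : Algebra.norm ℤ (σ • α) = Algebra.norm ℤ α := by
  have h : (Algebra.norm ℤ (σ • α) : ℚ) = (Algebra.norm ℤ α : ℚ) := by
    rw [Algebra.coe_norm_int, Algebra.coe_norm_int]
    exact Algebra.norm_eq_of_algEquiv σ (α : K)
  exact_mod_cast h

/-- **`N(α) > 0` for `α ≠ 0` in an imaginary quadratic field.** [cite: Cox2013, §7.A (7.6)] -/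
theorem norm_pos_of_ne_zero (hK2 : Module.finrank ℚ K = 2) [IsTotallyComplex K] {α : 𝓞 K} (hα : α ≠ 0) :
    0 < Algebra.norm ℤ α := by
  haveI : Algebra.IsQuadraticExtension ℚ K := ⟨hK2⟩
  haveI : IsCMField K := IsCMField.ofCMExtension ℚ K
  have h := Literature.NumberTheory.ComplexMultiplication.CMTypeLattice.norm_pos hK2
    (x := (α : K)) (by exact_mod_cast hα)
  rw [← Algebra.coe_norm_int] at h
  exact_mod_cast h

/-- `N((α)) = N(α)` as integers when `N(α) > 0`. [cite: Cox2013, §7.B Lemma 7.14 (i)] -/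
theorem absNorm_span_singleton_eq_norm {α : 𝓞 K} (hpos : 0 < Algebra.norm ℤ α) :
    (Ideal.absNorm (Ideal.span {α}) : ℤ) = Algebra.norm ℤ α := by
  rw [Ideal.absNorm_span_singleton, Int.natCast_natAbs, abs_of_pos hpos]

/-- `N((σα)) = N((α))`. [cite: NeukirchANT1999, Ch. I §2 (2.6)] -/
theorem absNorm_span_singleton_smul (σ : K ≃ₐ[ℚ] K) (α : 𝓞 K) :
    Ideal.absNorm (Ideal.span {σ • α}) = Ideal.absNorm (Ideal.span {α}) := by
  rw [Ideal.absNorm_span_singleton, Ideal.absNorm_span_singleton, norm_smul_eq]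

/-! ### §3. `(σα)^k ≠ α^k` -/

/-- A `k`-th root of unity of `K` (`k > 0`) with `(𝓞 K)ˣ = {±1}` is `±1`. [cite: Cox2013, §7.A] -/
theorem eq_one_or_eq_neg_one_of_pow_eq_one (hunits : Nat.card (𝓞 K)ˣ = 2) {ζ : K} {k : ℕ} (hk : 0 < k)
    (hζ : ζ ^ k = 1) : ζ = 1 ∨ ζ = -1 := by
  have hint : IsIntegral ℤ ζ := by
    refine IsIntegral.of_pow hk ?_
    rw [hζ]; exact isIntegral_one
  set z : 𝓞 K := ⟨ζ, hint⟩ with hz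
  have hzK : ((z : 𝓞 K) : K) = ζ := rfl
  have hzk : z ^ k = 1 := by
    refine RingOfIntegers.ext ?_
    rw [RingOfIntegers.coe_eq_algebraMap, map_pow, ← RingOfIntegers.coe_eq_algebraMap, hzK, hζ,
      RingOfIntegers.coe_eq_algebraMap, map_one]
  have hu : IsUnit z := IsUnit.of_pow_eq_one hzk (Nat.pos_iff_ne_zero.mp hk)
  rcases units_eq_one_or_eq_neg_one_of_natCard_eq_two hunits hu.unit with h | h
  · left
    have h' : (hu.unit : 𝓞 K) = 1 := by rw [h, Units.val_one]
    rw [IsUnit.unit_spec] at h'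
    rw [← hzK, h', RingOfIntegers.coe_eq_algebraMap, map_one]
  · right
    have h' : (hu.unit : 𝓞 K) = -1 := by rw [h, Units.val_neg, Units.val_one]
    rw [IsUnit.unit_spec] at h'
    rw [← hzK, h', RingOfIntegers.coe_eq_algebraMap, map_neg, map_one]

/-- ★ **`(σα)^k ≠ α^k` for the asymmetric twister.** Let `(𝓞 K)ˣ = {±1}`, `σ ∈ Aut(K/ℚ)` with
`σ • 𝔭_v̄ = 𝔭_v`, `2 ∉ 𝔭_v²`, and `α ∈ 𝓞 K` with `α − 1 ∈ 𝔭_v²`, `α − 1 ∈ 𝔭_v̄^{n+1}`, `α − 1 ∉ 𝔭_v^{n+1}`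
(`n ≥ 1`). Then `(σα)^k ≠ α^k` in `K` for every `k > 0`: otherwise `σα/α` is a root of unity, i.e. `±1`;
`σα = α` contradicts `α − 1 ∉ 𝔭_v^{n+1}` (as `σα − 1 ∈ σ•𝔭_v̄^{n+1} = 𝔭_v^{n+1}`), and `σα = −α` gives
`2 = (α − 1) − (σα − 1)·(−1)… ∈ 𝔭_v²`. This is the input `hne` of `hτ_artin` (independence of the two
twisters `(α)`, `(σα)` in the `𝔭`-adic tower). [cite: deShalit1987, II.4.12 (p. 66–68), II.4.17 (p. 77–78)] -/
theorem pow_smul_ne_pow (hunits : Nat.card (𝓞 K)ˣ = 2) {v vbar : HeightOneSpectrum (𝓞 K)}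
    {σ : K ≃ₐ[ℚ] K} (hσ : σ • vbar.asIdeal = v.asIdeal) (h2 : (2 : 𝓞 K) ∉ v.asIdeal ^ 2)
    {α : 𝓞 K} {n : ℕ} (hn : 1 ≤ n) (hα2 : α - 1 ∈ v.asIdeal ^ 2)
    (hαbar : α - 1 ∈ vbar.asIdeal ^ (n + 1)) (hαv : α - 1 ∉ v.asIdeal ^ (n + 1))
    {k : ℕ} (hk : 0 < k) : ((σ • α : 𝓞 K) : K) ^ k ≠ ((α : 𝓞 K) : K) ^ k := by
  intro hpow
  have hσα : σ • α - 1 ∈ v.asIdeal ^ (n + 1) := by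
    rw [← hσ, ← smul_pow']
    exact (sub_one_mem_smul_iff σ _ α).mpr hαbar
  have hα0' : α ≠ 0 := by
    rintro rfl
    rw [zero_sub, neg_mem_iff] at hα2
    exact v.isPrime.ne_top ((Ideal.eq_top_iff_one _).mpr (Ideal.pow_le_self two_ne_zero hα2))
  have hα0 : ((α : 𝓞 K) : K) ≠ 0 := by
    rw [Ne, RingOfIntegers.coe_eq_algebraMap, map_eq_zero_iff _ (RingOfIntegers.coe_injective)]
    exact hα0'
  -- `ζ = σα / α` is a `k`-th root of unity
  set ζ : K := ((σ • α : 𝓞 K) : K) / ((α : 𝓞 K) : K) with hζ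
  have hζk : ζ ^ k = 1 := by
    rw [hζ, div_pow, hpow, div_self (pow_ne_zero _ hα0)]
  rcases eq_one_or_eq_neg_one_of_pow_eq_one hunits hk hζk with h | h
  · -- `σα = α`
    have heq : ((σ • α : 𝓞 K) : K) = ((α : 𝓞 K) : K) := by
      rw [hζ, div_eq_one_iff_eq hα0] at h; exact h
    have heq' : σ • α = α := by exact_mod_cast heq
    rw [heq'] at hσα
    exact hαv hσα
  · -- `σα = -α`: then `2 ∈ 𝔭_v²`
    have heq : ((σ • α : 𝓞 K) : K) = -((α : 𝓞 K) : K) := by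
      rw [hζ, div_eq_iff hα0, neg_one_mul] at h; exact h
    have heq' : σ • α = -α := by exact_mod_cast heq
    rw [heq'] at hσα
    have h2' : (2 : 𝓞 K) = -((α - 1) + (-α - 1)) := by ring
    apply h2
    rw [h2', neg_mem_iff]
    exact Ideal.add_mem _ hα2 (Ideal.pow_le_pow_right (by omega) hσα)

end Literature.NumberTheory.NumberFields

end
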